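import Literature.Computability.Complexity.ThresholdPP
import Literature.Computability.Complexity.AdaptiveQueries
import Literature.Computability.Complexity.KannanLanguage
import HarnessLib

/-!
# Binary search with a `PP` oracle: two witness counts are available bit by bit to a `P^{PP}` machine

Topic `Computability/Complexity` (counting classes), continuing `ThresholdPP.lean` (the `PP` oracle
`TLang V r ∋ ⟨x, ⟨t, ν⟩⟩ ↔ val(ν) < #V(x, t)`) and `AdaptiveQueries.lean` (bounded adaptive
reductions `adLang ∈ P^A`). Arora–Barak 2009, §17.2.1, proof of Lemma 17.7: a `#P` value
`< 2^D` is recovered with `D` adaptive `PP` questions "is the value `> θ`?" by binary search from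
the most significant bit down (the folklore "`P^{#P} = P^{PP}`"); the second half of Toda's theorem
(Arora–Barak 2009, proof of Thm. 17.14, p. 423: one `#SAT`-type query after derandomisation) needs
two such values (the positive and negative halves of a `GapP` function) and a polynomial-time
post-processing of their binary digits.

* `qryNum D a = 1^{D−1−|a|} 0 aᴿ` — the threshold (little-endian) asked after the answers `a`
  (most significant bits first): `val = 2^{j} − 1 + 2^{j+1}·(high bits)`, `j = D − 1 − |a|`;
  **`qryNum_lt_iff`**: for `S < 2^D`, the answer `[val(qryNum D ((msb D S) ↾ k)) < S]` is the
  `k`-th most significant digit of `S` (`msb D S = (natBits D S)ᴿ`);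
* `qryFn r` — the query generator in `FP` (rounds `< D = r(|x|) + 1` search `#V(x, [1])`, the next
  `D` rounds `#V(x, [0])`; `reverse_mem_FP` re-proved from `Com.pour` to keep the import closure
  inside `Complexity/`, twin of `QuantumComplexity/RevUncomputeUniform.reverse_mem_FP`);
  **`adBits_qryFn`**: after `2D` rounds the answers are `msb D #V(x,[1]) ++ msb D #V(x,[0])`;
* `evalFn r E` — the evaluator handing `⟨x, ⟨natBits D #V(x,[1]), natBits D #V(x,[0])⟩⟩` to a
  post-processing language `E ∈ P`;
* **`countsLang_mem_PRelClass_PP`**: for `V, E ∈ P`,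
  `{x | ⟨x, ⟨natBits D #V(x,[1]), natBits D #V(x,[0])⟩⟩ ∈ E} ∈ P^{PP}`.

## References

* S. Arora, B. Barak, *Computational Complexity: A Modern Approach*, CUP 2009, §17.2.1, Lemma 17.7
  (proof: binary search), proof of Thm. 17.14 (p. 423), §3.4 (adaptive oracle machines).
-/

namespace Literature.Computability.Complexity

open _root_.Computability Polynomial PRelSigma OracleCompose TTClosure AdQuery ThresholdPP

namespace BinSearchPP

/-! ### Digits -/

/-- The most-significant-first digits of `S` in width `D`. [folklore] -/
def msb (D S : ℕ) : List Bool := (natBits D S).reverse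

/-- `msb D S` has length `D`. [folklore] -/
@[simp] theorem length_msb (D S : ℕ) : (msb D S).length = D := by simp [msb]

/-- The digits of `natBits`: digit `i` is `[S / 2^i is odd]`. [folklore] -/
theorem getElem_natBits : ∀ (D S : ℕ) {i : ℕ} (hi : i < (natBits D S).length),
    (natBits D S)[i] = decide (S / 2 ^ i % 2 = 1)
  | 0, S, i, hi => by simp at hi
  | D + 1, S, 0, _ => by simp [natBits]
  | D + 1, S, i + 1, hi => by
    have hi' : i < (natBits D (S / 2)).length := by simpa [natBits] using hi
    simp only [natBits, List.getElem_cons_succ, getElem_natBits D (S / 2) hi', Nat.div_div_eq_div_mul,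
      pow_succ']

/-- `val(1ʲ) = 2ʲ − 1`. [folklore] -/
theorem bitsToNat_replicate_true (j : ℕ) : bitsToNat (List.replicate j true) = 2 ^ j - 1 := by
  induction j with
  | zero => rfl
  | succ j ih =>
    rw [List.replicate_succ, bitsToNat_cons, ih, pow_succ]
    have : 1 ≤ 2 ^ j := Nat.one_le_two_pow
    simp; omega

/-- `val` of a suffix is the quotient by a power of two. [folklore] -/
theorem bitsToNat_drop {l : List Bool} {n : ℕ} (hn : n ≤ l.length) : bitsToNat (l.drop n) = bitsToNat l / 2 ^ n := by
  have h := bitsToNat_append (l.take n) (l.drop n)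
  rw [List.take_append_drop, List.length_take, min_eq_left hn] at h
  have hlt : bitsToNat (l.take n) < 2 ^ n := by
    have := bitsToNat_lt (l.take n)
    rwa [List.length_take, min_eq_left hn] at this
  rw [h, Nat.add_mul_div_left _ _ (Nat.two_pow_pos n), Nat.div_eq_of_lt hlt, Nat.zero_add]

/-- **The threshold asked after the answers `a`** (most significant bits first, `|a| < D`):
little-endian `1^{D−1−|a|} 0 aᴿ`. (Arora–Barak 2009, proof of Lemma 17.7: binary search.)
[cite: AroraBarak2009, Lemma 17.7 (proof)] -/
def qryNum (D : ℕ) (a : List Bool) : List Bool :=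
  List.replicate (D - 1 - a.length) true ++ false :: a.reverse

/-- Arithmetic of one binary-search step: `2ʲ − 1 + 2^{j+1}·(S / 2^{j+1}) < S ↔ S / 2ʲ` is odd.
[folklore] -/
theorem step_arith (S j : ℕ) : 2 ^ j - 1 + 2 ^ (j + 1) * (S / 2 ^ (j + 1)) < S ↔ S / 2 ^ j % 2 = 1 := by
  have h3 : S / 2 ^ (j + 1) = S / 2 ^ j / 2 := by rw [pow_succ, Nat.div_div_eq_div_mul]
  rw [h3, pow_succ]
  have hP : 1 ≤ 2 ^ j := Nat.one_le_two_pow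
  have h1 := Nat.div_add_mod S (2 ^ j)
  have h2 := Nat.div_add_mod (S / 2 ^ j) 2
  have hr : S % 2 ^ j < 2 ^ j := Nat.mod_lt _ (by omega)
  have hb : S / 2 ^ j % 2 < 2 := Nat.mod_lt _ two_pos
  set P := 2 ^ j
  set q := S / P
  set M := q / 2
  set b := q % 2
  set r0 := S % P
  have hN : P * 2 * M = 2 * (P * M) := by ring
  rw [hN]
  set N := P * M
  have hS : S = 2 * N + P * b + r0 := by rw [← h1, ← h2]; ring
  rcases Nat.lt_or_ge b 1 with hb0 | hb1
  · have hb0' : b = 0 := by omega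
    rw [hb0', mul_zero, add_zero] at hS
    omega
  · have hb1' : b = 1 := by omega
    rw [hb1', mul_one] at hS
    omega

/-- **One step of the binary search reads one digit**: for `S < 2^D` and `k < D`, the oracle's
answer to the threshold built from the `k` most significant digits of `S` is digit `k` (from the
top) of `S`. [cite: AroraBarak2009, Lemma 17.7 (proof)] -/
theorem qryNum_lt_iff {D S k : ℕ} (hS : S < 2 ^ D) (hk : k < D) :
    (bitsToNat (qryNum D ((msb D S).take k)) < S) ↔ (msb D S)[k]'(by simp; omega) = true := by
  have hlen : (natBits D S).length = D := length_natBits D S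
  have htake : ((msb D S).take k).reverse = (natBits D S).drop (D - k) := by
    simp only [msb]
    rw [List.take_reverse, List.reverse_reverse, hlen]
  have hval : bitsToNat (qryNum D ((msb D S).take k)) = 2 ^ (D - 1 - k) - 1 + 2 ^ (D - 1 - k + 1) * (S / 2 ^ (D - k)) := by
    rw [qryNum, bitsToNat_append, bitsToNat_replicate_true, List.length_replicate, List.length_take, length_msb,
      min_eq_left hk.le, bitsToNat_cons, htake, bitsToNat_drop (by omega), bitsToNat_natBits hS]
    simp [pow_succ]; ring
  have hj : D - k = D - 1 - k + 1 := by omega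
  rw [hval, hj, step_arith]
  -- digit `k` from the top is digit `D - 1 - k` of `natBits`
  have hidx : D - 1 - k < (natBits D S).length := by omega
  simp only [msb, List.getElem_reverse, hlen]
  rw [getElem_natBits D S]
  simp only [decide_eq_true_eq]

/-! ### String reversal in `FP` -/

/-- **String reversal is polynomial time** (one pass pouring the input register onto the output
register, `Com.pour`); twin of `QuantumComplexity/RevUncomputeUniform.reverse_mem_FP`, re-proved to
keep the import closure inside `Complexity/`. [Arora–Barak 2009, §1.3] [folklore] -/
theorem reverse_mem_FP : (List.reverse : List Bool → List Bool) ∈ FP := by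
  refine Com.mem_FP (ι := Bool) (Com.pour true false) true false (3 * Polynomial.X + 1) _ fun z =>
    ⟨_, Or.inl ((Com.runs_pour (ι := Bool) (a := true) (b := false) (by decide) (Regs.init true z)).mono
      (by simp [Regs.init])), by simp [Regs.init]⟩

/-! ### The query generator and the evaluator -/

section Machine

variable (r : Polynomial ℕ)

/-- The digit count `D = r + 1` as a polynomial. [folklore] -/
noncomputable def DP : Polynomial ℕ := r + 1

/-- `D(n) = r(n) + 1`. [folklore] -/
@[simp] theorem eval_DP (n : ℕ) : (DP r).eval n = r.eval n + 1 := by simp [DP]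

/-- The threshold string `1^{D−1−|a'|} 0 a'ᴿ` built from the answer segment returned by `aF`
(`1ᴰ = padFn (DP r)` of the input pair `⟨x, a⟩`, shortened by `|a'| + 1` with `Kannan.sufFn`).
[folklore] -/
noncomputable def numFn (aF : List Bool → List Bool) : List Bool → List Bool :=
  concatFn ∘ pairFn (Kannan.sufFn aF (padFn (DP r))) (List.cons false ∘ List.reverse ∘ aF)

/-- The query on a segment: `⟨x, ⟨tag, numFn⟩⟩`. [folklore] -/
noncomputable def qryOn (tag : List Bool) (aF : List Bool → List Bool) : List Bool → List Bool :=
  pairFn fstP (pairFn (fun _ => tag) (numFn r aF))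

/-- **The query generator**: in the first `D` rounds search `#V(x, [1])` with all answers so far,
afterwards search `#V(x, [0])` with the answers past the first `D`. [cite: AroraBarak2009, Lemma 17.7 (proof)] -/
noncomputable def qryFn : List Bool → List Bool :=
  condFn (LenLt (DP r)) (qryOn r [true] sndP) (qryOn r [false] (sndP ∘ dropSndFn (DP r)))

/-- **The evaluator**: hand `⟨x, ⟨(a ↾ D)ᴿ, (a ⇂ D)ᴿ⟩⟩` to the post-processing language `E`.
[folklore] -/
noncomputable def evalLang (E : Language Bool) : Language Bool :=
  pairFn fstP (pairFn (List.reverse ∘ sndP ∘ truncSndFn (DP r)) (List.reverse ∘ sndP ∘ dropSndFn (DP r))) ⁻¹' E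

variable {r}

/-- `numFn ∈ FP`. [folklore] -/
theorem numFn_mem_FP {aF : List Bool → List Bool} (haF : aF ∈ FP) : numFn r aF ∈ FP :=
  comp_mem_FP concatFn_mem_FP (pairFn_mem_FP (Kannan.sufFn_mem_FP haF (padFn_mem_FP _))
    (comp_mem_FP (cons_mem_FP false) (comp_mem_FP reverse_mem_FP haF)))

/-- `qryOn ∈ FP`. [folklore] -/
theorem qryOn_mem_FP (tag : List Bool) {aF : List Bool → List Bool} (haF : aF ∈ FP) : qryOn r tag aF ∈ FP :=
  pairFn_mem_FP fstP_mem_FP (pairFn_mem_FP (const_mem_FP tag) (numFn_mem_FP haF))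

/-- **`qryFn ∈ FP`.** [folklore] -/
theorem qryFn_mem_FP : qryFn r ∈ FP :=
  condFn_mem_FP (LenLt_mem_P _) (qryOn_mem_FP _ sndP_mem_FP)
    (qryOn_mem_FP _ (comp_mem_FP sndP_mem_FP (dropSndFn_mem_FP _)))

/-- **`evalLang E ∈ P`** for `E ∈ P`. [folklore] -/
theorem evalLang_mem_P {E : Language Bool} (hE : E ∈ Classes.P) : evalLang r E ∈ Classes.P :=
  preimage_mem_P hE (pairFn_mem_FP fstP_mem_FP (pairFn_mem_FP
    (comp_mem_FP reverse_mem_FP (comp_mem_FP sndP_mem_FP (truncSndFn_mem_FP _)))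
    (comp_mem_FP reverse_mem_FP (comp_mem_FP sndP_mem_FP (dropSndFn_mem_FP _)))))

/-- Value of `numFn` on a pair. [folklore] -/
theorem numFn_apply {aF : List Bool → List Bool} (x a : List Bool) :
    numFn r aF (boolPair x a) = qryNum (r.eval x.length + 1) (aF (boolPair x a)) := by
  simp [numFn, qryNum, Kannan.sufFn_apply, padFn_apply, List.drop_replicate]

/-- **Value of the query generator** on `⟨x, a⟩` (`D = r(|x|) + 1`): in round `|a| < D` the query
`⟨x, ⟨[1], qryNum D a⟩⟩`, afterwards `⟨x, ⟨[0], qryNum D (a ⇂ D)⟩⟩`. [cite: AroraBarak2009, Lemma 17.7 (proof)] -/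
theorem qryFn_apply (x a : List Bool) :
    qryFn r (boolPair x a) =
      if a.length < r.eval x.length + 1 then boolPair x (boolPair [true] (qryNum (r.eval x.length + 1) a))
      else boolPair x (boolPair [false] (qryNum (r.eval x.length + 1) (a.drop (r.eval x.length + 1)))) := by
  rw [qryFn, condFn_apply, boolPair_mem_LenLt, eval_DP]
  split_ifs with h
  · rw [qryOn, pairFn_apply, pairFn_apply, fstP_boolPair, numFn_apply x a, sndP_boolPair]
  · rw [qryOn, pairFn_apply, pairFn_apply, fstP_boolPair, numFn_apply x a]
    simp [dropSndFn_boolPair]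

/-- Membership in `evalLang`. [folklore] -/
theorem mem_evalLang_iff {E : Language Bool} (x a : List Bool) :
    boolPair x a ∈ evalLang r E ↔
      boolPair x (boolPair (a.take (r.eval x.length + 1)).reverse (a.drop (r.eval x.length + 1)).reverse) ∈ E := by
  rw [evalLang, memL_preimage]
  simp [truncSndFn_boolPair, dropSndFn_boolPair]

end Machine

/-! ### The answers are the digits -/

section Semantics

variable (V : Language Bool) (r : Polynomial ℕ) (x : List Bool)

local notation "𝔇" => Polynomial.eval (List.length x) r + 1

/-- The two searched values: `S₁ = #V(x, [1])`, `S₀ = #V(x, [0])`. [folklore] -/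
noncomputable def val (b : Bool) : ℕ := cntV V r x [b]

/-- The searched values are `< 2ᴰ` (there are at most `2^{r|x|}` witnesses). [folklore] -/
theorem val_lt (b : Bool) : val V r x b < 2 ^ 𝔇 := by
  have := cnt_le (r.eval x.length) {y | boolPair (boolPair x [b]) y ∈ V}
  have hpos : 0 < 2 ^ (r.eval x.length) := Nat.two_pow_pos _
  change cnt (r.eval x.length) {y | boolPair (boolPair x [b]) y ∈ V} < 2 ^ 𝔇
  rw [pow_succ]; omega

/-- The intended answer string: the digits of `S₁` then of `S₀`, most significant first. [folklore] -/
noncomputable def digits : List Bool := msb 𝔇 (val V r x true) ++ msb 𝔇 (val V r x false)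

variable {V r x}

/-- **The answers of the binary search are the digits** (invariant of Arora–Barak's binary search,
proof of Lemma 17.7): after `k ≤ 2D` rounds, `adBits = digits ↾ k`. [cite: AroraBarak2009, Lemma 17.7 (proof)] -/
theorem adBits_eq_take : ∀ k ≤ 2 * 𝔇, adBits (qryFn r) (TLang V r) x k = (digits V r x).take k
  | 0, _ => by simp
  | k + 1, hk => by
    have ih := adBits_eq_take k (by omega)
    rw [adBits_succ, ih, List.take_succ_eq_append_getElem (by simp [digits]; omega)]
    congr 1
    rw [List.singleton_inj, qryFn_apply, List.length_take, min_eq_left (by simp [digits]; omega)]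
    by_cases hkD : k < 𝔇
    · -- first phase: the value `S₁`
      rw [if_pos hkD]
      have hmem : boolPair x (boolPair [true] (qryNum 𝔇 ((digits V r x).take k))) ∈ TLang V r ↔
          (msb 𝔇 (val V r x true))[k]'(by simp; omega) = true := by
        rw [mem_TLang_iff, digits, List.take_append_of_le_length (by simp; omega)]
        exact qryNum_lt_iff (val_lt V r x true) hkD
      have hget : (digits V r x)[k]'(by simp [digits]; omega) = (msb 𝔇 (val V r x true))[k]'(by simp; omega) := by
        simp only [digits]; rw [List.getElem_append_left (by simp; omega)]
      rw [hget]
      by_cases hb : (msb 𝔇 (val V r x true))[k]'(by simp; omega) = true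
      · rw [hb]; exact (Set.mem_iff_boolIndicator _ _).1 (hmem.2 hb)
      · rw [Bool.not_eq_true] at hb
        rw [hb]; exact (Set.notMem_iff_boolIndicator _ _).1 (fun h => by rw [hmem.1 h] at hb; exact Bool.noConfusion hb)
    · -- second phase: the value `S₀`
      rw [if_neg hkD]
      have hk' : k - 𝔇 < 𝔇 := by omega
      have hdrop : ((digits V r x).take k).drop 𝔇 = (msb 𝔇 (val V r x false)).take (k - 𝔇) := by
        rw [digits, List.take_append, List.take_of_length_le (l := msb 𝔇 (val V r x true)) (by simp; omega),
          length_msb]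
        exact List.drop_left' (length_msb _ _)
      have hmem : boolPair x (boolPair [false] (qryNum 𝔇 (((digits V r x).take k).drop 𝔇))) ∈ TLang V r ↔
          (msb 𝔇 (val V r x false))[k - 𝔇]'(by simp; omega) = true := by
        rw [mem_TLang_iff, hdrop]
        exact qryNum_lt_iff (val_lt V r x false) hk'
      have hget : (digits V r x)[k]'(by simp [digits]; omega) = (msb 𝔇 (val V r x false))[k - 𝔇]'(by simp; omega) := by
        simp only [digits]; rw [List.getElem_append_right (by simp; omega)]; simp
      rw [hget]
      by_cases hb : (msb 𝔇 (val V r x false))[k - 𝔇]'(by simp; omega) = true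
      · rw [hb]; exact (Set.mem_iff_boolIndicator _ _).1 (hmem.2 hb)
      · rw [Bool.not_eq_true] at hb
        rw [hb]; exact (Set.notMem_iff_boolIndicator _ _).1 (fun h => by rw [hmem.1 h] at hb; exact Bool.noConfusion hb)

/-- **After `2D` rounds the answers are all the digits.** [cite: AroraBarak2009, Lemma 17.7 (proof)] -/
theorem adBits_qryFn : adBits (qryFn r) (TLang V r) x (2 * 𝔇) = digits V r x := by
  rw [adBits_eq_take _ le_rfl, List.take_of_length_le (by simp [digits]; omega)]

/-- Reading the two little-endian numerals off the digit string. [folklore] -/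
theorem take_drop_digits :
    ((digits V r x).take 𝔇).reverse = natBits 𝔇 (val V r x true) ∧
      ((digits V r x).drop 𝔇).reverse = natBits 𝔇 (val V r x false) := by
  constructor
  · rw [digits, List.take_append_of_le_length (by simp), List.take_of_length_le (by simp), msb, List.reverse_reverse]
  · rw [digits, List.drop_append_of_le_length (by simp), List.drop_of_length_le (by simp), List.nil_append, msb,
      List.reverse_reverse]

end Semantics

/-! ### Main result -/

/-- The polynomial round budget `2(r + 1)`. [folklore] -/
noncomputable def roundsP (r : Polynomial ℕ) : Polynomial ℕ := 2 * (r + 1)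

/-- **Two witness counts are available, digit by digit, to a `P^{PP}` computation.** For a witness
language `V ∈ P`, a witness length polynomial `r` (`D = r + 1` digits) and a post-processing
language `E ∈ P`:
`{x | ⟨x, ⟨natBits D #V(x,[1]), natBits D #V(x,[0])⟩⟩ ∈ E} ∈ P^{PP}` — the language *is* the
bounded adaptive reduction `adLang (qryFn r) (2(r+1)) (evalLang r E)` to the `PP` threshold oracle
`TLang V r`. (Arora–Barak 2009, §17.2.1, proof of Lemma 17.7: binary search with `PP` questions;
the form with two counts and a post-processing predicate is the one consumed by the proof of
Thm. 17.14.) [cite: AroraBarak2009, Lemma 17.7 (proof)] -/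
theorem countsLang_mem_PRelClass_PP {V E : Language Bool} (hV : V ∈ Classes.P) (hE : E ∈ Classes.P)
    (r : Polynomial ℕ) :
    {x | boolPair x (boolPair (natBits (r.eval x.length + 1) (cntV V r x [true]))
        (natBits (r.eval x.length + 1) (cntV V r x [false]))) ∈ E} ∈ PRelClass PP := by
  have hEq : ({x | boolPair x (boolPair (natBits (r.eval x.length + 1) (cntV V r x [true]))
      (natBits (r.eval x.length + 1) (cntV V r x [false]))) ∈ E} : Language Bool) =
      adLang (qryFn r) (roundsP r) (evalLang r E) (TLang V r) := by
    refine Set.ext fun x => ?_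
    change _ ↔ boolPair x (adBits (qryFn r) (TLang V r) x ((roundsP r).eval x.length)) ∈ evalLang r E
    rw [show (roundsP r).eval x.length = 2 * (r.eval x.length + 1) by simp [roundsP],
      adBits_qryFn, mem_evalLang_iff, (take_drop_digits (V := V) (r := r) (x := x)).1,
      (take_drop_digits (V := V) (r := r) (x := x)).2]
    rfl
  rw [hEq]
  exact adLang_mem_PRelClass qryFn_mem_FP (evalLang_mem_P hE) (TLang_mem_PP hV)

end BinSearchPP

end Literature.Computability.Complexity
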